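import Summits.KontsevichZagierPeriods.KontsevichZagierPeriods.Theses.PeriodConductors
import Literature.Barriers.ABC.SzpiroEpsilonCannotBeDroppedProofs

/-!
# `RationalTwoCuts` (stmt-KontsevichZagierPeriods-8409, route PeriodConductors) — proof

The `{2}`-unit equation over `ℚ`: for `c : ℚ`,
`(c ≠ 0 ∧ c ≠ 1 ∧ ∀ p prime, p ≠ 2 → ord_p c = 0 ∧ ord_p (1 - c) = 0) ↔ (c = 1/2 ∨ c = 2 ∨ c = -1)`,
i.e. the rational points `c` with `c` and `1 - c` both `{2}`-units are exactly `1/2, 2, -1` (so `1/2` is the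
only interior rational cut of a `{0,1}`-walled axis over `ℤ[1/2]`).

Proof. (⇐) For an odd prime `p`, `p ∤ 2`, so `ord_p 2 = ord_p (1/2) = ord_p (-1) = 0`, and `1 - c` runs
through `1/2, -1, 2`. (⇒) Write `c = n / d` in lowest terms (`n = c.num`, `d = c.den ≥ 1`). For an odd prime
`p`, `ord_p c = 0` and coprimality force `p ∤ n`, `p ∤ d`
(`Literature.Barriers.ABC.BennettYazdani.not_dvd_num_den_of_padicValRat_eq_zero`), and then
`ord_p (1 - c) = ord_p (c - 1) = ord_p (n - d) = 0` forces `p ∤ n - d`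
(`Literature.Barriers.ABC.BennettYazdani.padicValRat_sub_one_eq`). An odd integer without odd prime factors
is `±1` (its least prime factor would be an odd prime). As `n`, `d` are coprime they are not both even, so at
least two of `n`, `d`, `n - d` are odd, hence `±1`; together with `d ≥ 1`, `n ≠ 0`, `n ≠ d` (`c ≠ 1`) a linear
case analysis (`omega`) leaves `(n, d) ∈ {(1, 2), (2, 1), (-1, 1)}`, i.e. `c ∈ {1/2, 2, -1}`.
Elementary and self-contained; it is the case `K = ℚ`, `S = {2}` of the finiteness of solutions of the
`S`-unit equation `x + y = 1` (Evertse–Győry). Lead c10 of crux `TateLifting` (stmt-9129), banking support items.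
-/

namespace Summit.KontsevichZagierPeriods.PeriodConductors

/-- For an odd prime `p`, `ord_p 2 = 0` (as a `padicValRat`). [folklore] -/
theorem padicValRat_two_of_odd_prime {p : ℕ} (hp : p.Prime) (hp2 : p ≠ 2) :
    padicValRat p 2 = 0 := by
  have h : ¬ p ∣ 2 := fun h => hp2 ((Nat.prime_dvd_prime_iff_eq hp Nat.prime_two).mp h)
  have h2 : padicValRat p ((2 : ℕ) : ℚ) = 0 := by
    rw [padicValRat.of_nat, padicValNat.eq_zero_of_not_dvd h, Nat.cast_zero]
  simpa using h2

/-- An odd integer with no odd prime divisor is `±1`: otherwise its least prime factor is an odd prime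
dividing it. [folklore] -/
theorem eq_one_or_eq_neg_one_of_odd_of_forall_odd_prime_not_dvd {z : ℤ} (h2 : ¬ (2 : ℤ) ∣ z)
    (h : ∀ p : ℕ, p.Prime → p ≠ 2 → ¬ (p : ℤ) ∣ z) : z = 1 ∨ z = -1 := by
  suffices hz : z.natAbs = 1 by omega
  by_contra h1
  have hp : z.natAbs.minFac.Prime := Nat.minFac_prime h1
  have hdvd : (z.natAbs.minFac : ℤ) ∣ z := Int.natCast_dvd.mpr (Nat.minFac_dvd _)
  refine h _ hp ?_ hdvd
  intro hp2
  rw [hp2] at hdvd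
  exact h2 (by exact_mod_cast hdvd)

/-- The arithmetic core of (⇒): if `c : ℚ` is `≠ 0, ≠ 1` and no odd prime divides `c.num`, `c.den` or
`c.num - c.den`, then `(c.num, c.den) ∈ {(1, 2), (2, 1), (-1, 1)}`. Two of the three pairwise "coprime mod 2"
numbers are odd, hence `±1`, and `omega` finishes. [folklore] -/
theorem num_den_of_forall_odd_prime_not_dvd {c : ℚ} (hc0 : c ≠ 0) (hc1 : c ≠ 1)
    (key : ∀ p : ℕ, p.Prime → p ≠ 2 →
      ¬ (p : ℤ) ∣ c.num ∧ ¬ (p : ℤ) ∣ (c.den : ℤ) ∧ ¬ (p : ℤ) ∣ (c.num - c.den)) :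
    (c.num = 1 ∧ c.den = 2) ∨ (c.num = 2 ∧ c.den = 1) ∨ (c.num = -1 ∧ c.den = 1) := by
  have hA : ¬ (2 : ℤ) ∣ c.num → c.num = 1 ∨ c.num = -1 := fun h2 =>
    eq_one_or_eq_neg_one_of_odd_of_forall_odd_prime_not_dvd h2 fun p hp hp2 => (key p hp hp2).1
  have hB : ¬ (2 : ℤ) ∣ (c.den : ℤ) → (c.den : ℤ) = 1 ∨ (c.den : ℤ) = -1 := fun h2 =>
    eq_one_or_eq_neg_one_of_odd_of_forall_odd_prime_not_dvd h2 fun p hp hp2 => (key p hp hp2).2.1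
  have hC : ¬ (2 : ℤ) ∣ (c.num - c.den) → c.num - c.den = 1 ∨ c.num - c.den = -1 := fun h2 =>
    eq_one_or_eq_neg_one_of_odd_of_forall_odd_prime_not_dvd h2 fun p hp hp2 => (key p hp hp2).2.2
  have hcop : ¬ ((2 : ℤ) ∣ c.num ∧ (2 : ℤ) ∣ (c.den : ℤ)) := by
    rintro ⟨hn, hd⟩
    have h1 : 2 ∣ c.num.natAbs := Int.natCast_dvd.mp hn
    have h2 : 2 ∣ c.den := Int.natCast_dvd_natCast.mp hd
    exact absurd (Nat.eq_one_of_dvd_coprimes c.reduced h1 h2) (by decide)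
  have hn0 : c.num ≠ 0 := Rat.num_ne_zero.mpr hc0
  have hd0 : 0 < c.den := c.den_pos
  have hnd : c.num ≠ (c.den : ℤ) := by
    intro h
    apply hc1
    have h' : (c.num : ℚ) = (c.den : ℚ) := by exact_mod_cast h
    have hd : (c.den : ℚ) ≠ 0 := by exact_mod_cast c.den_pos.ne'
    rw [← Rat.num_div_den c, h', div_self hd]
  omega

/-- **`RationalTwoCuts`** (route PeriodConductors, stmt-KontsevichZagierPeriods-8409): for `c : ℚ`,
`c ≠ 0 ∧ c ≠ 1 ∧ (∀ p prime, p ≠ 2 → ord_p c = 0 ∧ ord_p (1 - c) = 0) ↔ c ∈ {1/2, 2, -1}` — the `{2}`-unit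
equation `x + y = 1` over `ℚ`. (⇐) is a direct valuation computation; (⇒) writes `c = n/d` in lowest terms,
shows no odd prime divides `n`, `d`, `n - d`, so the two odd ones among them are `±1`, and a parity/size case
analysis leaves `(n, d) ∈ {(1,2), (2,1), (-1,1)}`. [folklore] -/
theorem rationalTwoCuts_proof :
    Summit.KontsevichZagierPeriods.KontsevichZagierPeriods.Theses.PeriodConductors.RationalTwoCuts := by
  intro c
  constructor
  · rintro ⟨hc0, hc1, H⟩
    have hnd : c.num ≠ (c.den : ℤ) := by
      intro h
      apply hc1
      have h' : (c.num : ℚ) = (c.den : ℚ) := by exact_mod_cast h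
      have hd : (c.den : ℚ) ≠ 0 := by exact_mod_cast c.den_pos.ne'
      rw [← Rat.num_div_den c, h', div_self hd]
    have key : ∀ p : ℕ, p.Prime → p ≠ 2 →
        ¬ (p : ℤ) ∣ c.num ∧ ¬ (p : ℤ) ∣ (c.den : ℤ) ∧ ¬ (p : ℤ) ∣ (c.num - c.den) := by
      intro p hp hp2
      haveI := Fact.mk hp
      obtain ⟨hv, hv'⟩ := H p hp hp2
      obtain ⟨hn, hd⟩ :=
        Literature.Barriers.ABC.BennettYazdani.not_dvd_num_den_of_padicValRat_eq_zero hc0 hv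
      refine ⟨hn, hd, ?_⟩
      have h0 : padicValInt p (c.num - c.den) = 0 := by
        have h1 := Literature.Barriers.ABC.BennettYazdani.padicValRat_sub_one_eq (p := p) (q := c) hd
        rw [← neg_sub c 1, padicValRat.neg] at hv'
        rw [hv'] at h1
        exact_mod_cast h1.symm
      rcases padicValInt.eq_zero_iff.mp h0 with h' | h' | h'
      · exact absurd h' hp.ne_one
      · exact absurd (sub_eq_zero.mp h') hnd
      · exact h'
    rcases num_den_of_forall_odd_prime_not_dvd hc0 hc1 key with ⟨hn, hd⟩ | ⟨hn, hd⟩ | ⟨hn, hd⟩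
    · left
      rw [← Rat.num_div_den c, hn, hd]
      norm_num
    · right; left
      rw [← Rat.num_div_den c, hn, hd]
      norm_num
    · right; right
      rw [← Rat.num_div_den c, hn, hd]
      norm_num
  · rintro (rfl | rfl | rfl)
    · refine ⟨by norm_num, by norm_num, fun p hp hp2 => ?_⟩
      haveI := Fact.mk hp
      have h2 := padicValRat_two_of_odd_prime hp hp2
      constructor
      · rw [one_div, padicValRat.inv, h2, neg_zero]
      · rw [show (1 : ℚ) - 1 / 2 = 2⁻¹ by norm_num, padicValRat.inv, h2, neg_zero]
    · refine ⟨by norm_num, by norm_num, fun p hp hp2 => ⟨padicValRat_two_of_odd_prime hp hp2, ?_⟩⟩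
      rw [show (1 : ℚ) - 2 = -1 by norm_num, padicValRat.neg, padicValRat.one]
    · refine ⟨by norm_num, by norm_num, fun p hp hp2 => ⟨?_, ?_⟩⟩
      · rw [padicValRat.neg, padicValRat.one]
      · rw [show (1 : ℚ) - -1 = 2 by norm_num]
        exact padicValRat_two_of_odd_prime hp hp2

end Summit.KontsevichZagierPeriods.PeriodConductors
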